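import Summits.QuantumFields.YangMills.Theorems.QuantileBitPurityGAxisDomination
import Summits.QuantumFields.YangMills.Theorems.QuantileBitPurityGAxisNumerics
import Summits.QuantumFields.YangMills.Theorems.QuantileBitPurityHolonomyQuantileSubQuarticOfPeriodic
import HarnessLib

/-!
# `QuantileBitPurity.HolonomyQuantileSubQuartic` — the sub-quartic holonomy quantile (crux h₁ of route `QuantileBitPurity`), PROVED

Closes item stmt-QuantumFields-23948 (LINE g12-B of seat ym-idea-4; route `QuantileBitPurity`, rank 2) BY NAME:

★ `holonomyQuantileSubQuartic_proof : Theses.QuantileBitPurity.HolonomyQuantileSubQuartic` — with `γc = 2/5`, `q = 1 − (1 − q₀)/8`,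
`q₀ = (e + 1/2)/(e + 1)`, `a = 1/400`, `L₀ = 2`: on the window `2 ≤ L ≤ β^a`, `β ≥ β₀`, the un-normalised zero-flux thermal weight of the slice event
`{polDist U₀ ≤ β^(−2/5)}` (the `x`-Polyakov holonomy through the origin within `β^(−2/5)` of the centre) is at most `q · Z_phys(L × L³)`.

Assembly: the periodic-sector door `QuantileBitPurity.holonomyQuantileSubQuartic_of_periodic` (sector decomposition + Tomboulis–Yaffe ∕ Kanazawa twist
inequality, tree) reduces the crux to the CORE ESTIMATE IN THE UNTWISTED SEAM SECTOR, which is `GAxis.sectorWeight_core_le_of_numerics` (ONE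
seam-axis transported sheet shift with Jacobian exactly `1`: the `x`-links issuing from the plane `x₀ = 0` of every slice are multiplied by a rotation of
angle `2β^(−2/5)` about an axis adapted to the seam field ∕ the transverse holonomies and transported along a comb read from slice `0`; second-order cost
`O(β^(−1/10+6a))`, bad fields `O(β^(−a))`) fed with `GAxis.gaxis_numerics_of_le`.

HONEST LABEL: one crux (h₁) of a DRAFT-by-design line; a fixed-lattice estimate uniform on the window `L ≤ β^(1/400)`; the route's h₂
(`EquatorBandVanishing`, the flux wall) is untouched; nothing about infinite volume, the continuum limit or the Clay Yang–Mills gap — the YM mass gap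
is NOT proved here.  No `sorry`, no new axiom, no new definition.  References: [cite: Luscher1983, §2]; [cite: tHooft1979];
[cite: MontvayMunster1994, (3.145)].
-/

set_option autoImplicit false

noncomputable section

open MeasureTheory Real
open Literature.MathematicalPhysics.QuantumLattice
open Literature.MathematicalPhysics.QuantumFieldTheory hiding SU2
open Summit.QuantumFields.YangMills.Theorems
open Summit.QuantumFields.YangMills.Theorems.FemtoTransferGap
open Summit.QuantumFields.YangMills.Theorems.FemtoTransferGap.TT

namespace Summit.QuantumFields.YangMills.Theorems.QuantileBitPurity

/-- ★ **Crux h₁ of route `QuantileBitPurity`, proved**: the sub-quartic holonomy quantile `HolonomyQuantileSubQuartic` (`γc = 2/5`,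
`q = 1 − (1 − (e + 1/2)/(e + 1))/8`, `a = 1/400`, `L₀ = 2`). [cite: Luscher1983, §2] [cite: tHooft1979] [cite: MontvayMunster1994, (3.145)] -/
theorem holonomyQuantileSubQuartic_proof : Summit.QuantumFields.YangMills.Theses.QuantileBitPurity.HolonomyQuantileSubQuartic := by
  obtain ⟨β₀, hnum⟩ := GAxis.gaxis_numerics_of_le (a := 1 / 400) (by norm_num) le_rfl
  refine holonomyQuantileSubQuartic_of_periodic ⟨2 / 5, by norm_num, le_rfl, (Real.exp 1 + 1 / 2) / (Real.exp 1 + 1), ?_, 1 / 400, by norm_num,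
    β₀, 2, fun β hβ L _ hL2 hLa => ?_⟩
  · rw [div_lt_one (by positivity)]; linarith
  · obtain ⟨h200, hθ1, hQ, hG⟩ := hnum β hβ L (le_trans (by norm_num) hL2) hLa
    exact GAxis.sectorWeight_core_le_of_numerics (L := L) h200 hL2 hθ1 hQ hG (by norm_num)

end Summit.QuantumFields.YangMills.Theorems.QuantileBitPurity

end
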